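import Summits.QuantumFields.YangMills.Theorems.UnitScaleTiltProp7LODCubeGaugeFamily
import HarnessLib

/-!
# Route `UnitScaleTilt`, crux K1 «MinimiserStabilityRegPr» (stmt-QuantumFields-19200), EX face — K-storey (px12 g16 LOCATE-K137), pen (K1b-a) «transported right inverse of `Q_k(U₀)`»
# (px13 g15, LOCATE `ym3-torus-px13/g15/LOCATE-K1b-a-px13g15.md`), engine brick — **THE AVERAGING OPERATOR OF RECORD ON A LOCAL FIELD IS THE FRAMED FLAT AVERAGE OF THE
# AXIALLY GAUGED FIELD, IN `L²`, WITH THE CUBE GAUGE DISCHARGED**: for `A` supported within `tdist(c, ·) ≤ R₀` of a centre `c` (no-wrap `2(R₀ + 8ℓ + 1) ≤ N₀`),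
# `‖Q_k(U₀)Ã − η•toL2B(c' ↦ Ad_{w_c(c')}(QTwS 1 (Ad_{σ_c}A) c'))‖² ≤ 4·(3·10¹⁰L¹⁰ε₀² + 192(ℓδ_c)²)·(cB∕(c₀ℓ^d))·‖Ã‖²`, `σ_c = axialT U₀ c`, `δ_c = 2·regThreshold·(R₀ + 7ℓ)` — K-FREE

Cell `ym3-torus` (HUMAN RULING D-0037; rung R3 = SU(2) YM₃ on T³ — NOT d = 4, NOT infinite volume, NOT a mass gap, NOT Clay).  Width seat `ym3-torus-px13` (gen 15).  THEOREMS ONLY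
(0 `def`, 0 `sorry`); `--supports stmt-QuantumFields-19200 --as helper`; count-neutral.

THE POINT.  routeR-w4 g26's (L5c) block-set edition ✓`Prop7QkLocalGaugeComparisonBlockSet.normSq_Qk_sub_framed_Qk_one_le_of_blockSet` displays the gauge's flatness on a block set `S`
(`hax`) and `S ⊇` the block neighbourhood of `supp A` (`hS`); ✓`Prop7LODCubeGaugeFamily` discharges both for the axial CUBE gauge `σ_c := axialT U₀ c` and a field supported in the
`R₀`-ball of `c` (✓`norm_gaugeAct_axialT_sub_one_le_of_mem_blockSet`, ✓`hS_of_tdist`), and typed the RELATIVE∕LOWER rows that way (✓`normSq_Qk_one_conj_le_cubeGauge`) — but not the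
DIFFERENCE row.  This file is that one corollary (the proof of ✓`normSq_Qk_one_conj_le_cubeGauge` with its last line replaced): the row (K1b-a) reads per transported bump — a LOCAL
field `A_y` dressed by `σ_{c_y}` has `Q_k(U₀)(toL2 A_y) = η•toL2B(Ad_{w}(QTwS 1 X_y)) + O(√ρ)·‖toL2 A_y‖`, `X_y = Ad_{σ}A_y` the FLAT bump, `ρ = 4(3·10¹⁰L¹⁰ε₀² + 192(ℓδ_c)²)·cB∕(c₀ℓ^d)`,
`ℓδ_c = 2ε₀(R₀∕ℓ + 7)` K-free for `R₀ = O(ℓ)`; with `(cB∕(c₀ℓ^d))·‖toL2 A_y‖² = O(cB‖V y‖²)` the books close in the `toL2B` currency exactly (LOCATE §2∕§4).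

WHAT IS PROVED (ns `…Theorems.Prop7QkFramedFlatCubeGauge`): ★★ `normSq_Qk_sub_framed_Qk_one_le_cubeGauge`.
HONEST SCOPE.  A 40-line knit over landed rows; the bump, row (a), (s1)∕(s2), (K1b), the K137 rows, EX and the crux are NOT proved here.

References: T. Bałaban, CMP **99** (1985) 389–434 [Balaban1985BackgroundPropagators] ((3.13)–(3.16) p.393, Thm 3.11 p.416); CMP **99** (1985) 75–102 [Balaban1985RegularSpaces]
(Lemma 1 (1.24)–(1.25) p.79); CMP **98** (1985) 17–51 [Balaban1985Averaging] (Prop. 3 (124)–(126) p.36, Prop. 4 (134)–(135) p.38); CMP **102** (1985) 277–309 [Balaban1985Variational] ((2) p.278).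
-/

set_option autoImplicit false

noncomputable section

open scoped BigOperators Matrix.Norms.L2Operator Matrix

namespace Summit.QuantumFields.YangMills.Theorems.Prop7QkFramedFlatCubeGauge

open Literature.MathematicalPhysics.QuantumFieldTheory.Balaban1983to89
open Literature.MathematicalPhysics.QuantumFieldTheory.Balaban1983to89.T3ContinuumYM3Torus
open Finset T4Continuum BlockAveraging LatticeFieldCalculus B1RG242Torus
open B5Eq118OneStroke (iterBlockOf)
open B7Eq78Linearization (conjR)
open B10Eq27TorusAxialLog (axialT unitsField toUField suIncl)
open B11Eq103H1Complex (BondL2K)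
open B15DeterminingSets (embIter)
open T3LevelShift (bondShift)
open T3PrintedRegularOrbits (sites_eq)
open T3PrintedRegularMinimiser (RegPr)
open T3RegularMinimiser (regThreshold regThreshold_pos)
open T3SectALandauChart (eta)
open Summit.QuantumFields.YangMills.Theorems.Prop7SectET3HilbertLetters (toL2 toL2B)
open Summit.QuantumFields.YangMills.Theorems.Prop7SectET3CurvedPropagators (Qk)
open Summit.QuantumFields.YangMills.Theorems.Prop7SymAvgTwSym (QTwS)
open Summit.QuantumFields.YangMills.Theorems.Prop7QkLocalGaugeComparisonBlockSet (normSq_Qk_sub_framed_Qk_one_le_of_blockSet)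
open Summit.QuantumFields.YangMills.Theorems.Prop7LODCubeGaugeFamily (norm_gaugeAct_axialT_sub_one_le_of_mem_blockSet hS_of_tdist)

variable (F : T3Family) (n K : ℕ) (h : n ≤ K) (c₀ cB : ℝ) [Fact (0 < c₀)] [Fact (0 < cB)]

/-- ★★ **THE FRAMED-FLAT DIFFERENCE ROW WITH THE CUBE GAUGE DISCHARGED**: `RegPr F n K ε₀ W`, `10¹⁰L⁶ε₀ ≤ 1`, `10¹²L³ε₀ ≤ 1`, centre `c`, field `A` with `A b ≠ 0 → tdist(c, b₋) ≤ R₀`,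
no-wrap `2(R₀ + 8ℓ + 1) ≤ (F.P K).sitesPerDir 0` ⟹ with `σ_c := axialT W c` and the frames `w_c(c') = Φ(ĉ')⁻¹·σ_c(corner ĉ')⁻¹` of ✓`normSq_Qk_sub_framed_Qk_one_le`:
`‖Q_k(W)(toL2 A) − η•toL2B(c' ↦ Ad_{w_c(c')}(QTwS 1 (Ad_{σ_c}A) c'))‖² ≤ 4·(3·10¹⁰L¹⁰ε₀² + 192(ℓ·2·regThreshold·(R₀ + 7ℓ))²)·(cB∕(c₀ℓ^d))·‖toL2 A‖²`.
PROOF: the proof of ✓`Prop7LODCubeGaugeFamily.normSq_Qk_one_conj_le_cubeGauge` (block set `S_c(R₀ + 4ℓ)`, `hax` by ✓`norm_gaugeAct_axialT_sub_one_le_of_mem_blockSet`, `hS` by ✓`hS_of_tdist`,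
monotonicity `2a₀(R₀ + 4ℓ + 3(ℓ−1)) ≤ 2a₀(R₀ + 7ℓ)`) with ✓`normSq_Qk_sub_framed_Qk_one_le_of_blockSet` as the last line.
[cite: Balaban1985BackgroundPropagators, (3.13)-(3.16) p.393, Thm 3.11 p.416; Balaban1985RegularSpaces, Lemma 1 (1.25) p.79; Balaban1985Averaging, Prop. 4 (134)-(135) p.38] -/
theorem normSq_Qk_sub_framed_Qk_one_le_cubeGauge {ε₀ : ℝ} (hε₀ : 0 < ε₀) (hε : 10 ^ 10 * (F.L : ℝ) ^ 6 * ε₀ ≤ 1) (hε12 : 10 ^ 12 * (F.L : ℝ) ^ 3 * ε₀ ≤ 1)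
    (W : GaugeField (F.P K) 0 (Matrix.specialUnitaryGroup (Fin 2) ℂ)) (hreg : RegPr F n K ε₀ W) (c : Site (F.P K) 0)
    (A : PBond (F.P K) 0 → Matrix (Fin 2) (Fin 2) ℂ) {R₀ : ℕ} (hA : ∀ b, A b ≠ 0 → Site.tdist c b.src ≤ R₀)
    (hwrap : 2 * (R₀ + 8 * (F.P K).L ^ (K - n) + 1) ≤ (F.P K).sitesPerDir 0) :
    ‖Qk F n K h c₀ cB W (toL2 F K c₀ A)
        - ((eta F n K : ℝ) : ℂ) • toL2B F n cB (fun c' => conjR ((axialT (unitsField (toUField W)) (Site.fibreSite 0 (K - n) (bondShift (sites_eq F n K h) c').src fun _ => (⟨0, pow_pos (F.P K).L_pos (K - n)⟩ : Fin ((F.P K).L ^ (K - n)))) (embIter (K - n) (bondShift (sites_eq F n K h) c').src))⁻¹ * (Unitary.toUnits (suIncl ((axialT W c) (Site.fibreSite 0 (K - n) (bondShift (sites_eq F n K h) c').src fun _ => (⟨0, pow_pos (F.P K).L_pos (K - n)⟩ : Fin ((F.P K).L ^ (K - n)))))))⁻¹)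
            (QTwS F n K h (1 : GaugeField (F.P K) 0 (Matrix.specialUnitaryGroup (Fin 2) ℂ)) (fun b => (((axialT W c) b.src : Matrix.specialUnitaryGroup (Fin 2) ℂ) : Matrix (Fin 2) (Fin 2) ℂ) * A b * star (((axialT W c) b.src : Matrix.specialUnitaryGroup (Fin 2) ℂ) : Matrix (Fin 2) (Fin 2) ℂ)) c'))‖ ^ 2
      ≤ 4 * (3 * 10 ^ 10 * (F.L : ℝ) ^ 10 * ε₀ ^ 2 + 192 * ((F.L : ℝ) ^ (K - n) * (2 * regThreshold F n K ε₀ * ((R₀ : ℝ) + 7 * (F.L : ℝ) ^ (K - n)))) ^ 2)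
          * (cB / (c₀ * ((F.L : ℝ) ^ (K - n)) ^ (F.P K).d)) * ‖toL2 F K c₀ A‖ ^ 2 := by
  have hk : K - n ≤ (F.P K).m + (F.P K).K := by show K - n ≤ F.m + K; omega
  have hd : (F.P K).d = 3 := T3Family.P_d F K
  have hLL : ((F.P K).L : ℝ) = F.L := rfl
  have ha₀ := regThreshold_pos F (n := n) (K := K) hε₀
  have hU := hreg.plaqSmall
  have hL1 : (1 : ℝ) ≤ (F.L : ℝ) ^ (K - n) := by
    have h3 : 3 ≤ F.L := by obtain ⟨a, ha⟩ := F.hL.1; have := F.hL.2; omega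
    have : (1 : ℝ) ≤ F.L := by exact_mod_cast (le_trans (by norm_num) h3)
    exact one_le_pow₀ this
  -- the block set of radius `R₀ + 4ℓ` and its flatness `δ_c`
  have hwrapR : 2 * ((R₀ + ((F.P K).d + 1) * (F.P K).L ^ (K - n)) + (F.P K).d * (F.P K).L ^ (K - n) + 1) ≤ (F.P K).sitesPerDir 0 := by
    rw [hd]; omega
  have hax := norm_gaugeAct_axialT_sub_one_le_of_mem_blockSet hk W ha₀ hU c hwrapR
  have hS := hS_of_tdist hk c A hA
  have hδ : 0 ≤ 2 * regThreshold F n K ε₀ * ((R₀ : ℝ) + 7 * (F.L : ℝ) ^ (K - n)) := by positivity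
  -- monotonicity: `2a₀(R₀ + 4ℓ + 3(ℓ − 1)) ≤ 2a₀(R₀ + 7ℓ)`
  have hmono : 2 * regThreshold F n K ε₀ * ((((R₀ + ((F.P K).d + 1) * (F.P K).L ^ (K - n) : ℕ)) : ℝ) + ((F.P K).d : ℝ) * ((((F.P K).L : ℝ)) ^ (K - n) - 1))
      ≤ 2 * regThreshold F n K ε₀ * ((R₀ : ℝ) + 7 * (F.L : ℝ) ^ (K - n)) := by
    rw [hd]; push_cast; simp only [hLL]
    nlinarith [ha₀.le, hL1]
  have hax' : ∀ b : PBond (F.P K) 0, iterBlockOf (K - n) b.src ∈ {Y : Site (F.P K) (K - n) | ∃ x : Site (F.P K) 0, iterBlockOf (K - n) x = Y ∧ Site.tdist c x ≤ R₀ + ((F.P K).d + 1) * (F.P K).L ^ (K - n)} →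
      iterBlockOf (K - n) b.tgt ∈ {Y : Site (F.P K) (K - n) | ∃ x : Site (F.P K) 0, iterBlockOf (K - n) x = Y ∧ Site.tdist c x ≤ R₀ + ((F.P K).d + 1) * (F.P K).L ^ (K - n)} →
      ‖((GaugeField.gaugeAct (axialT W c) W b : Matrix.specialUnitaryGroup (Fin 2) ℂ) : Matrix (Fin 2) (Fin 2) ℂ) - 1‖ ≤ 2 * regThreshold F n K ε₀ * ((R₀ : ℝ) + 7 * (F.L : ℝ) ^ (K - n)) :=
    fun b hb hb' => (hax b hb hb').trans hmono
  exact normSq_Qk_sub_framed_Qk_one_le_of_blockSet F n K h c₀ cB hε₀ hε hε12 W hreg (axialT W c) hδ A _ hax' hS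

end Summit.QuantumFields.YangMills.Theorems.Prop7QkFramedFlatCubeGauge

end
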